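import Mathlib.RingTheory.Polynomial.Eisenstein.Basic
import Mathlib.RingTheory.Polynomial.GaussLemma
import Mathlib.FieldTheory.RatFunc.AsPolynomial
import Literature.NumberTheory.EllipticCurves.FrobeniusSeparableProofs
import Literature.NumberTheory.EllipticCurves.IsogenyFactorProofs
import HarnessLib

/-!
# `deg φ = q` for the `q`-power Frobenius (Silverman, *AEC*, Prop. II.2.11(c)): proof of `frobeniusIsogeny_deg_eq_card`

Trunk T-ELLARITH (group G16). Sibling *proofs* file (theorems only) of
`Literature.NumberTheory.EllipticCurves.FrobeniusEndomorphism`, **discharging its named fact**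
`WeierstrassCurve.frobeniusIsogeny_deg_eq_card W` — Silverman, *The Arithmetic of Elliptic Curves*,
Prop. II.2.11(c) for an elliptic curve `E` over a finite field `k` with `q` elements: the `q`-power
Frobenius endomorphism `φ : (x, y) ↦ (x^q, y^q)` has degree `deg φ = [K̄(E) : φ^* K̄(E)] = q` —
as `WeierstrassCurve.frobeniusIsogeny_deg_eq_card_holds`. Consumers `(hdeg : W.frobeniusIsogeny_deg_eq_card)`
(`FrobeniusEndomorphism`, `FrobeniusTateModuleProofs`, `IsogenyDeterminantProofs`:
`det(φ_ℓ) = deg φ = q`) are fed `frobeniusIsogeny_deg_eq_card_holds W`.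

## The proof (a degree count; Silverman's goes through II.2.11(a),(b): `φ^* K(C) = K(C)^q`)

Let `L = K̄(E) = K̄(x, y)`, `F = φ^* L = K̄(x^q, y^q)` (`pullbackField_frobeniusIsogeny`; here
`φ^* x = x^q`, `φ^* y = y^q`), `L₀ = K̄(x^q)`. Two towers over `L₀`:

* `L₀ ⊆ L₀(x) = K̄(x) ⊆ L`: `[K̄(x) : K̄(x^q)] = q`, because `T^q - x^q` is irreducible over
  `K̄(x^q) ≅ K̄(v)` — it is `T^q - v`, Eisenstein at the prime `v` of `K̄[v]`, hence irreducible
  over `Frac K̄[v]` by Gauss's lemma (`Literature.NumberTheory.EllipticCurves.irreducible_X_pow_sub_C_gen`, for any transcendental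
  `v` and any exponent `n ≥ 1`; `Literature.NumberTheory.EllipticCurves.finrank_adjoin_pow_adjoin`); and `[L : K̄(x)] = 2`: `≤ 2`
  as `y` is a root of the (monic quadratic) Weierstrass equation over `K̄(x)`, `≥ 2` as
  `y ∉ K̄(x)` (`genY_pow_not_mem_adjoin_genX_pow` at exponent `1`).
* `L₀ ⊆ F = L₀(y^q) ⊆ L`: `[F : L₀] = 2`: `≤ 2` as `(x^q, y^q)` satisfies the Weierstrass
  equation (`E` is defined over `k = 𝔽_q`), `≥ 2` as `y^q ∉ K̄(x^q)`; and `[L : F] = deg φ`.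

Hence `2q = [L : L₀] = 2 deg φ`. The statement `y^n ∉ K̄(x^n)` (`n = q^m`) is the parity argument
of `IsogenyFactorProofs` (`exists_finite_hasValueAt_neg_of_mem_adjoin_simple`): an element of
`K̄(x^n)` takes the same value at `P` and `-P`, whereas `y(P)^n = y(-P)^n` forces `y(P) = y(-P)`
(`a ↦ a^n` is injective on `K̄`, `n` a power of the characteristic), i.e. `2P = O`, for all but
finitely many `P` — impossible, `E[2]` being finite and `E(K̄)` infinite.

## References

* [SilvermanAEC2009] J. H. Silverman, *The Arithmetic of Elliptic Curves*, 2nd ed., GTM 106,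
  Springer 2009: Prop. II.2.11 (PDF p. 35), Example III.4.6, V.§2 (proof of Thm. V.2.3.1:
  "`det(φ_ℓ) = deg(φ) = q`").

## Design

`noncomputable section`, `open scoped Classical`, one universe `u`; nothing is defined. The
field-theoretic lemma (`X^n - v` irreducible over `k(v)`, `[k(x) : k(x^n)] = n`) is proved for
any field `k` in `namespace Literature` from Mathlib's Eisenstein criterion
(`Polynomial.IsEisensteinAt.irreducible`), Gauss's lemma
(`Polynomial.IsPrimitive.irreducible_iff_irreducible_map_fraction_map`) and
`RatFunc.algEquivOfTranscendental` (`k(v) ≅ RatFunc k`); Mathlib has no "degree of `k(x)` over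
`k(f(x))`" formula (Lüroth-type statements are absent).
-/

noncomputable section

open scoped Classical

open Polynomial IntermediateField

universe u

/-! ## `X^n - v` is irreducible over `k(v)`; `[k(x) : k(x^n)] = n` -/

namespace Literature.NumberTheory.EllipticCurves

variable {k : Type u} [Field k]

/-- **`T^n - v` is irreducible in `k[v][T]`** (`n ≥ 1`): it is Eisenstein at the prime ideal
`(v)` of `k[v]`. [folklore] -/
theorem irreducible_X_pow_sub_C_X {n : ℕ} (hn : 0 < n) :
    Irreducible ((X : (k[X])[X]) ^ n - C (X : k[X])) := by
  set f : (k[X])[X] := X ^ n - C (X : k[X]) with hf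
  have hmonic : f.Monic := monic_X_pow_sub_C _ hn.ne'
  have hdeg : f.natDegree = n := natDegree_X_pow_sub_C
  set P : Ideal k[X] := Ideal.span {(X : k[X])} with hP
  have hPprime : P.IsPrime := (Ideal.span_singleton_prime X_ne_zero).mpr prime_X
  have hcoeff0 : f.coeff 0 = -(X : k[X]) := by
    rw [hf, coeff_sub, coeff_X_pow, coeff_C_zero, if_neg hn.ne, zero_sub]
  refine Polynomial.IsEisensteinAt.irreducible (𝓟 := P) ⟨?_, ?_, ?_⟩ hPprime hmonic.isPrimitive
    (by rw [hdeg]; exact hn)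
  · -- leading coefficient `1 ∉ (v)`
    rw [hmonic.leadingCoeff, hP, Ideal.mem_span_singleton]
    exact fun h ↦ not_isUnit_X (isUnit_of_dvd_one h)
  · -- lower coefficients lie in `(v)`
    intro i hi
    rw [hdeg] at hi
    rcases Nat.eq_zero_or_pos i with rfl | hi0
    · rw [hcoeff0]
      exact P.neg_mem (Ideal.mem_span_singleton_self _)
    · rw [hf, coeff_sub, coeff_X_pow, coeff_C, if_neg hi.ne, if_neg hi0.ne', sub_zero]
      exact P.zero_mem
  · -- the constant coefficient `-v ∉ (v)²`
    rw [hcoeff0, hP, Ideal.span_singleton_pow, Ideal.mem_span_singleton]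
    intro h
    rw [dvd_neg, pow_two] at h
    have h1 : (X : k[X]) ∣ 1 := by
      have : (X : k[X]) * X ∣ X * 1 := by rwa [mul_one]
      exact (mul_dvd_mul_iff_left X_ne_zero).mp this
    exact not_isUnit_X (isUnit_of_dvd_one h1)

/-- **`T^n - v` is irreducible over the rational function field `k(v) = RatFunc k`** (Gauss's
lemma from the polynomial ring `k[v]`). [folklore] -/
theorem irreducible_X_pow_sub_C_ratFuncX {n : ℕ} (hn : 0 < n) :
    Irreducible ((X : (RatFunc k)[X]) ^ n - C (RatFunc.X : RatFunc k)) := by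
  have hmonic : ((X : (k[X])[X]) ^ n - C (X : k[X])).Monic := monic_X_pow_sub_C _ hn.ne'
  have h := (hmonic.isPrimitive.irreducible_iff_irreducible_map_fraction_map
    (K := RatFunc k)).mp (irreducible_X_pow_sub_C_X hn)
  simpa [Polynomial.map_sub, Polynomial.map_pow, RatFunc.algebraMap_X] using h

variable {L : Type u} [Field L] [Algebra k L]

/-- **`T^n - v` is irreducible over `k(v) ⊆ L` for `v ∈ L` transcendental over `k`** (transport
along `RatFunc k ≃ k(v)`, Mathlib's `RatFunc.algEquivOfTranscendental`). [folklore] -/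
theorem irreducible_X_pow_sub_C_gen {v : L} (hv : Transcendental k v) {n : ℕ} (hn : 0 < n) :
    Irreducible ((X : (k⟮v⟯)[X]) ^ n - C (AdjoinSimple.gen k v)) := by
  set e := RatFunc.algEquivOfTranscendental v hv with he
  have hX : e RatFunc.X = AdjoinSimple.gen k v :=
    Subtype.ext (RatFunc.algEquivOfTranscendental_X v hv)
  have hmap : Polynomial.mapEquiv e.toRingEquiv ((X : (RatFunc k)[X]) ^ n - C RatFunc.X) =
      (X : (k⟮v⟯)[X]) ^ n - C (AdjoinSimple.gen k v) := by
    rw [mapEquiv_apply, Polynomial.map_sub, Polynomial.map_pow, map_X, map_C]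
    congr 2
  rw [← hmap, MulEquiv.irreducible_iff]
  exact irreducible_X_pow_sub_C_ratFuncX hn

/-- **`[k(x) : k(x^n)] = n`** for `x ∈ L` transcendental over `k` and `n ≥ 1`: the minimal
polynomial of `x` over `k(x^n)` is `T^n - x^n`. [folklore] -/
theorem finrank_adjoin_pow_adjoin {x : L} (hx : Transcendental k x) {n : ℕ} (hn : 0 < n) :
    Module.finrank k⟮x ^ n⟯ (k⟮x ^ n⟯)⟮x⟯ = n := by
  set v := AdjoinSimple.gen k (x ^ n) with hv
  have hvt : Transcendental k (x ^ n) := hx.pow hn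
  set p : (k⟮x ^ n⟯)[X] := X ^ n - C v with hp
  have hpm : p.Monic := monic_X_pow_sub_C _ hn.ne'
  have hpx : aeval x p = 0 := by
    rw [hp, map_sub, map_pow, aeval_X, aeval_C, hv, AdjoinSimple.algebraMap_gen, sub_self]
  have hirr : Irreducible p := irreducible_X_pow_sub_C_gen hvt hn
  have hint : IsIntegral k⟮x ^ n⟯ x := ⟨p, hpm, by rwa [aeval_def] at hpx⟩
  rw [adjoin.finrank hint, ← minpoly.eq_of_irreducible_of_monic hirr hpx hpm]
  exact natDegree_X_pow_sub_C

end Literature.NumberTheory.EllipticCurves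

namespace WeierstrassCurve

open geomPoints

variable {K : Type u} [Field K] (W : WeierstrassCurve K)

/-! ## `a ↦ a ^ q^m` is injective on `K̄` -/

section PowInjective

variable (K) [Finite K]

/-- In characteristic `p`, `q = #k = p^n`: `a ↦ a ^ q^m` is injective on `K̄`. [folklore] -/
theorem pow_natCard_pow_injective (m : ℕ) :
    Function.Injective fun a : AlgebraicClosure K ↦ a ^ Nat.card K ^ m := by
  obtain ⟨n, hp, hq, -⟩ := exists_natCard_eq_ringChar_pow K
  haveI : Fact (ringChar K).Prime := ⟨hp⟩
  haveI : CharP (AlgebraicClosure K) (ringChar K) :=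
    (Algebra.charP_iff K (AlgebraicClosure K) (ringChar K)).mp (ringChar.charP K)
  intro a b hab
  simp only at hab
  rw [hq, ← pow_mul] at hab
  rw [← sub_eq_zero] at hab ⊢
  rw [← sub_pow_char_pow] at hab
  exact pow_eq_zero_iff (pow_ne_zero _ hp.ne_zero) |>.mp hab

end PowInjective

/-! ## `y^n ∉ K̄(x^n)` for `n = q^m` (the parity argument) -/

section Parity

/-- `x^n` has the same value at `P` and `-P` (for every affine `P`). [folklore] -/
theorem exists_finite_hasValueAt_neg_genX_pow (n : ℕ) :
    ∃ S : Set W.geomPoints, S.Finite ∧ ∀ P ∉ S, ∃ c,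
      W.HasValueAt (W.genX ^ n) P c ∧ W.HasValueAt (W.genX ^ n) (-P) c := by
  refine ⟨∅, Set.finite_empty, fun P _ ↦ ⟨xy P 0 ^ n, (hasValueAt_gen P 0).pow n, ?_⟩⟩
  have h := (hasValueAt_gen (W := W) (-P) 0).pow n
  rwa [geomPoints.xy_neg_zero] at h

variable [W.IsElliptic] [Finite K]

/-- **`y ^ q^m ∉ K̄(x ^ q^m)`** (`q = #k`): otherwise `y ^ q^m` would take the same value at `P`
and `-P` for almost all `P` (`exists_finite_hasValueAt_neg_of_mem_adjoin_simple`), so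
`y(P) = y(-P)` (`a ↦ a ^ q^m` is injective on `K̄`), i.e. `2P = O`, for all but finitely many `P`.
At `m = 0` this is `y ∉ K̄(x)`, i.e. `[K̄(E) : K̄(x)] ≥ 2` (Silverman, *AEC*, III.§1–2:
`[K̄(E) : K̄(x)] = 2`). [folklore] -/
theorem genY_pow_not_mem_adjoin_genX_pow (m : ℕ) :
    W.genY ^ Nat.card K ^ m ∉
      IntermediateField.adjoin (AlgebraicClosure K) {W.genX ^ Nat.card K ^ m} := by
  intro hmem
  obtain ⟨S, hS, hSP⟩ := exists_finite_hasValueAt_neg_of_mem_adjoin_simple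
    (exists_finite_hasValueAt_neg_genX_pow W (Nat.card K ^ m)) hmem
  apply ((hS.union (Set.finite_singleton (0 : W.geomPoints)))).infinite_compl
  refine (finite_geomTorsion W (two_ne_zero : (2 : ℤ) ≠ 0)).subset fun P hP ↦ ?_
  simp only [Set.mem_compl_iff, Set.mem_union, Set.mem_singleton_iff, not_or] at hP
  obtain ⟨hPS, hP0⟩ := hP
  have hnP0 : -P ≠ 0 := fun h ↦ hP0 (neg_eq_zero.mp h)
  obtain ⟨c, hc, hc'⟩ := hSP P hPS
  have h1 : xy P 1 ^ Nat.card K ^ m = c := ((hasValueAt_gen P 1).pow _).unique hP0 hc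
  have h2 : xy (-P) 1 ^ Nat.card K ^ m = c := ((hasValueAt_gen (-P) 1).pow _).unique hnP0 hc'
  have h12 : xy P 1 = xy (-P) 1 := pow_natCard_pow_injective K m (h1.trans h2.symm)
  exact (mem_torsionPoints_iff _ _ P).mpr (geomPoints.two_smul_eq_zero_of_xy_neg_one hP0 h12)

/-- `y ∉ K̄(x)`. Silverman, *AEC*, III.§1–2 (`[K̄(E) : K̄(x)] = 2`). [folklore] -/
theorem genY_not_mem_adjoin_genX :
    W.genY ∉ IntermediateField.adjoin (AlgebraicClosure K) {W.genX} := by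
  simpa using genY_pow_not_mem_adjoin_genX_pow W 0

end Parity

/-! ## `φ^* x = x^q`, `φ^* y = y^q`, `φ^* K̄(E) = K̄(x^q, y^q)` -/

section Pullback

variable {σ : Field.absoluteGaloisGroup K} (hσ : ∀ x : AlgebraicClosure K, σ • x = x ^ Nat.card K)

/-- The rational representation `(x^q / 1, y^q / 1)` of the Frobenius isogeny. [folklore] -/
theorem finite_not_agreesWithRationalMapAt_frobeniusIsogeny :
    {P : W.geomPoints | ¬ AgreesWithRationalMapAt W W (MvPolynomial.X 0 ^ Nat.card K) 1
      (MvPolynomial.X 1 ^ Nat.card K) 1 (W.frobeniusIsogeny hσ) P}.Finite :=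
  (Set.finite_singleton (0 : W.geomPoints)).subset fun P hP ↦ by
    by_contra h0
    exact hP (agreesWithRationalMapAt_frobenius W hσ h0)

variable [W.IsElliptic]

/-- **`φ^* x = x^q`.** Silverman, *AEC*, Example III.4.6, II.2.10. [folklore] -/
theorem pullbackX_frobeniusIsogeny : (W.frobeniusIsogeny hσ).pullbackX = W.genX ^ Nat.card K := by
  rw [(W.frobeniusIsogeny hσ).pullbackX_eq ⟨_, _, _, _,
    finite_not_agreesWithRationalMapAt_frobeniusIsogeny W hσ⟩, RationalRep.pullbackX]
  simp [evalGeneric_eq_aeval]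

/-- **`φ^* y = y^q`.** Silverman, *AEC*, Example III.4.6, II.2.10. [folklore] -/
theorem pullbackY_frobeniusIsogeny : (W.frobeniusIsogeny hσ).pullbackY = W.genY ^ Nat.card K := by
  rw [(W.frobeniusIsogeny hσ).pullbackY_eq ⟨_, _, _, _,
    finite_not_agreesWithRationalMapAt_frobeniusIsogeny W hσ⟩, RationalRep.pullbackY]
  simp [evalGeneric_eq_aeval]

/-- **`φ^* K̄(E) = K̄(x^q, y^q)`.** Silverman, *AEC*, Prop. II.2.11 (`φ^* K(C) = K(C)^q`).
[folklore] -/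
theorem pullbackField_frobeniusIsogeny :
    (W.frobeniusIsogeny hσ).pullbackField =
      IntermediateField.adjoin (AlgebraicClosure K) {W.genX ^ Nat.card K, W.genY ^ Nat.card K} := by
  rw [Isogeny.pullbackField, pullbackX_frobeniusIsogeny, pullbackY_frobeniusIsogeny]

end Pullback

/-! ## The degree count -/

section Degree

/-- **`[L₀(b) : L₀] ≤ 2` for a point `(a, b)` of `E` over `K̄(E)` with `a ∈ L₀`**: `b` is a root
of the Weierstrass polynomial of `E` with `x = a` substituted, a monic quadratic over `L₀`, and is
in particular integral over `L₀`. Silverman, *AEC*, III.§1. [folklore] -/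
theorem isIntegral_and_finrank_adjoin_le_two
    (L₀ : IntermediateField (AlgebraicClosure K) W.geomFunctionField) {a b : W.geomFunctionField}
    (ha : a ∈ L₀) (hab : (W.baseChange W.geomFunctionField).toAffine.Equation a b) :
    _root_.IsIntegral L₀ b ∧ Module.finrank L₀ (IntermediateField.adjoin L₀ {b}) ≤ 2 := by
  set q : L₀[X] := ((W.baseChange (AlgebraicClosure K)).toAffine.polynomial).map
    (eval₂RingHom (algebraMap (AlgebraicClosure K) L₀) ⟨a, ha⟩) with hq
  have hqm : q.Monic := (Affine.monic_polynomial (W := _)).map _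
  have hqdeg : q.natDegree = 2 := by
    rw [hq, (Affine.monic_polynomial (W := _)).natDegree_map, Affine.natDegree_polynomial]
  have hqb : aeval b q = 0 := by
    rw [aeval_def, hq, eval₂_map]
    have hcomp : (algebraMap L₀ W.geomFunctionField).comp
        (eval₂RingHom (algebraMap (AlgebraicClosure K) L₀) ⟨a, ha⟩) =
        eval₂RingHom (algebraMap (AlgebraicClosure K) W.geomFunctionField) a := by
      refine Polynomial.ringHom_ext (fun c ↦ ?_) ?_
      · simp only [RingHom.coe_comp, Function.comp_apply, coe_eval₂RingHom, eval₂_C]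
        exact (IsScalarTower.algebraMap_apply (AlgebraicClosure K) L₀ W.geomFunctionField c).symm
      · simp only [RingHom.coe_comp, Function.comp_apply, coe_eval₂RingHom, eval₂_X]
        rfl
    rw [hcomp, eval₂_eval₂RingHom_apply, ← baseChange_geomFunctionField_polynomial]
    exact hab
  have hint : _root_.IsIntegral L₀ b := ⟨q, hqm, by rwa [aeval_def] at hqb⟩
  refine ⟨hint, ?_⟩
  rw [IntermediateField.adjoin.finrank hint, ← hqdeg]
  exact natDegree_le_natDegree (minpoly.degree_le_of_ne_zero L₀ b hqm.ne_zero hqb)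

/-- If `b ∉ L₀` then `[L₀(b) : L₀] ≠ 1`. [folklore] -/
theorem finrank_adjoin_ne_one_of_not_mem
    (L₀ : IntermediateField (AlgebraicClosure K) W.geomFunctionField) {b : W.geomFunctionField}
    (hb : b ∉ L₀) : Module.finrank L₀ (IntermediateField.adjoin L₀ {b}) ≠ 1 := by
  intro h1
  rw [IntermediateField.finrank_eq_one_iff, IntermediateField.adjoin_simple_eq_bot_iff,
    IntermediateField.mem_bot] at h1
  obtain ⟨z, hz⟩ := h1
  exact hb (hz ▸ z.2)

/-- **Silverman, *AEC*, Prop. II.2.11(c): `deg φ = q`** for the `q`-power Frobenius endomorphism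
`φ` of an elliptic curve over a finite field with `q` elements — the named fact
`frobeniusIsogeny_deg_eq_card W` of `FrobeniusEndomorphism`, discharged (by the degree count of the
module docstring: `2q = [K̄(E) : K̄(x^q)] = 2 deg φ`). [cite: SilvermanAEC2009, Prop. II.2.11(c)] -/
theorem frobeniusIsogeny_deg_eq_card_holds : W.frobeniusIsogeny_deg_eq_card := by
  intro _ _ σ hσ
  set n := Nat.card K with hn
  have hn0 : 0 < n := by
    rw [hn]
    letI := Fintype.ofFinite K
    rw [Nat.card_eq_fintype_card]
    exact Fintype.card_pos
  -- the base `L₀ = K̄(x^q)`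
  set L₀ : IntermediateField (AlgebraicClosure K) W.geomFunctionField :=
    IntermediateField.adjoin (AlgebraicClosure K) {W.genX ^ n} with hL₀
  have hxqL₀ : W.genX ^ n ∈ L₀ := IntermediateField.mem_adjoin_simple_self _ _
  -- first tower: `L₀ ⊆ L₁ = L₀(x) ⊆ L`, degrees `q` and `2`
  set L₁ : IntermediateField L₀ W.geomFunctionField := IntermediateField.adjoin L₀ {W.genX}
    with hL₁
  have h01 : Module.finrank L₀ L₁ = n := Literature.NumberTheory.EllipticCurves.finrank_adjoin_pow_adjoin (transcendental_genX W) hn0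
  have hxL₁ : W.genX ∈ L₁ := IntermediateField.mem_adjoin_simple_self L₀ W.genX
  -- `K̄`-structure on `L₁`
  set L₁' : IntermediateField (AlgebraicClosure K) W.geomFunctionField :=
    L₁.restrictScalars (AlgebraicClosure K) with hL₁'
  have hxL₁' : W.genX ∈ L₁' := hxL₁
  -- `y` over `L₁`
  obtain ⟨hyint, hy2⟩ := isIntegral_and_finrank_adjoin_le_two W L₁' hxL₁' (equation_genX_genY W)
  have hyL₁ : W.genY ∉ L₁' := by
    intro h
    have h' : W.genY ∈ IntermediateField.adjoin (AlgebraicClosure K) {W.genX ^ n, W.genX} := by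
      rw [← IntermediateField.adjoin_simple_adjoin_simple]; exact h
    refine genY_not_mem_adjoin_genX W ((IntermediateField.adjoin_le_iff.mpr ?_) h')
    rintro z (rfl | hz)
    · exact pow_mem (IntermediateField.mem_adjoin_simple_self (AlgebraicClosure K) W.genX) n
    · rw [Set.mem_singleton_iff.mp hz]
      exact IntermediateField.mem_adjoin_simple_self (AlgebraicClosure K) W.genX
  have hy1 := finrank_adjoin_ne_one_of_not_mem W L₁' hyL₁
  -- `L₁(y) = L`
  have htop₁ : IntermediateField.adjoin L₁' {W.genY} = ⊤ := by
    rw [eq_top_iff]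
    intro z _
    have hle : IntermediateField.adjoin (AlgebraicClosure K) {W.genX, W.genY} ≤
        (IntermediateField.adjoin L₁' {W.genY}).restrictScalars (AlgebraicClosure K) := by
      rw [IntermediateField.adjoin_le_iff]
      rintro w (rfl | hw)
      · exact IntermediateField.algebraMap_mem (IntermediateField.adjoin L₁' {W.genY})
          (⟨W.genX, hxL₁'⟩ : L₁')
      · rw [Set.mem_singleton_iff.mp hw]
        exact IntermediateField.mem_adjoin_simple_self _ W.genY
    exact hle (by rw [adjoin_genX_genY_eq_top]; trivial)
  have h1L : Module.finrank L₁' W.geomFunctionField = 2 := by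
    have hfr : Module.finrank L₁' (IntermediateField.adjoin L₁' {W.genY}) =
        Module.finrank L₁' W.geomFunctionField := by
      rw [htop₁, IntermediateField.finrank_top']
    rw [← hfr]
    haveI : FiniteDimensional L₁' (IntermediateField.adjoin L₁' {W.genY}) :=
      IntermediateField.adjoin.finiteDimensional hyint
    haveI : Module.IsTorsionFree L₁' (IntermediateField.adjoin L₁' {W.genY}) :=
      DivisionSemiring.to_moduleIsTorsionFree
    have hpos : 0 < Module.finrank L₁' (IntermediateField.adjoin L₁' {W.genY}) :=
      Module.finrank_pos
    omega
  -- second tower: `L₀ ⊆ F = L₀(y^q) ⊆ L`, degrees `2` and `deg φ`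
  obtain ⟨hyqint, hyq2⟩ := isIntegral_and_finrank_adjoin_le_two W L₀ hxqL₀
    (nonsingular_gen_pow_natCard (W := W)).1
  have hyqL₀ : W.genY ^ n ∉ L₀ := by
    simpa [hL₀, pow_one] using genY_pow_not_mem_adjoin_genX_pow W 1
  have hyq1 := finrank_adjoin_ne_one_of_not_mem W L₀ hyqL₀
  set F : IntermediateField L₀ W.geomFunctionField := IntermediateField.adjoin L₀ {W.genY ^ n}
    with hF
  have h0F : Module.finrank L₀ F = 2 := by
    haveI : FiniteDimensional L₀ F := IntermediateField.adjoin.finiteDimensional hyqint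
    haveI : Module.IsTorsionFree L₀ F := DivisionSemiring.to_moduleIsTorsionFree
    have hpos : 0 < Module.finrank L₀ F := Module.finrank_pos
    omega
  set F' : IntermediateField (AlgebraicClosure K) W.geomFunctionField :=
    F.restrictScalars (AlgebraicClosure K) with hF'
  have hFdeg : Module.finrank F' W.geomFunctionField = (W.frobeniusIsogeny hσ).deg := by
    have hpb : (W.frobeniusIsogeny hσ).pullbackField = F' := by
      rw [pullbackField_frobeniusIsogeny, hF', hF, IntermediateField.adjoin_simple_adjoin_simple]
    rw [Isogeny.deg, hpb]
  -- the two towers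
  haveI : Module.Free L₀ L₁ := Module.Free.of_divisionRing L₀ L₁
  haveI : Module.Free L₁ W.geomFunctionField := Module.Free.of_divisionRing L₁ _
  haveI : Module.Free L₀ F := Module.Free.of_divisionRing L₀ F
  haveI : Module.Free F W.geomFunctionField := Module.Free.of_divisionRing F _
  have hT₁ := Module.finrank_mul_finrank L₀ L₁ W.geomFunctionField
  have hT₂ := Module.finrank_mul_finrank L₀ F W.geomFunctionField
  have h1L' : Module.finrank L₁ W.geomFunctionField = 2 := h1L
  have hFdeg' : Module.finrank F W.geomFunctionField = (W.frobeniusIsogeny hσ).deg := hFdeg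
  rw [h01, h1L'] at hT₁
  rw [h0F, hFdeg', ← hT₁] at hT₂
  -- `2 * deg φ = q * 2`
  have h2 : 2 * (W.frobeniusIsogeny hσ).deg = 2 * n := by rw [hT₂, mul_comm]
  exact Nat.eq_of_mul_eq_mul_left (by norm_num) h2

end Degree

end WeierstrassCurve
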